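/-
Origin: expansion seat `prover-pub-hodgecm-mc-binder-2-g6-0`, handover #2 13:47Z md5 13e0d54cb896 (175 l.; imports #1; `archWeilRep_rhoSD` (w2 exact), `archWeilRep_eq_smul_of_covariant` (lift-free Schur), `liftsTo_opTransport_archWeilRep`) (`HOME/mc/pub-hodgecm-mc-binder-2/g6/pkg/HodgeCM/Model/HypCensus/ArchDatum.lean`, md5 13e0d54c, 175 lines);
landed by the gen-12 packager (p-g12) in gate run 36 as `HodgeCM/Model/HypCensus/ArchDatum.lean` (verbatim).
-/
/-
Origin: speedrun cell pub-hodgecm, MODEL-CONSTRUCTION sub-cell, lineage mc-binder-2 (rows A12/A34: `hyp12` / `hyp34`;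
junction (J-arch) of BINDER-TRIAGE §50.2, BOOKED to this lineage by the desk ((RRRR′)(6) / model1-g6 §51.3)), seat
prover-pub-hodgecm-mc-binder-2-g6-0 (gen 6), 2026-08-19.  Target in PKG: `HodgeCM/Model/HypCensus/ArchDatum.lean`
(NEW additive leaf; RUN 36+, after K-1).  KERNEL only: 0 records / named facts, 0 proof holes.
-/
import Summits.HodgeConjecture.HodgeCM.Model.HypCensus.ArchFactor_2
import Literature.NumberTheory.Weil1964.AdelicMetaplecticArchRepCovariant
import Literature.NumberTheory.Weil1964.ArchFollandCocycleOne
import Literature.Analysis.SegalBargmann.SchwartzHeisenbergSchur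
import Literature.Analysis.SegalBargmann.SchwartzCompactWeilRep

/-!
# Census kit (rows A12/A34), junction (J-arch) §3: towards `IsArchWeilDatum` for `archWeilRep`

`ArchFactor.lean` produced, for any splitting `s : G₁(𝔸_F) →* Mp_ψ(𝕎_𝔸)ᶜᵒⁿᵗ` over `toSp` of the GR91 dual pair, the
archimedean Weil REPRESENTATION `archWeilRep … s hs` of `U(J_V)(E⊗ℝ) × U(J_W)(E⊗ℝ)` on `𝓢((F ⊗ ℝ)^n)` with
`ω_ψ(s(x_∞ ⊗ y_∞)) = archWeilRep (x,y) ⊗ 1`.  This file collects the three clauses of the tree's `IsArchWeilDatum`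
for it; §3(a) is done here, §3(b)/(c) are the successor's (plan in the lane HANDOFF-g6 §5/§6 and model1-g6's content
word STATUS 12:14:15Z):

* §3(a) **`archWeilRep_rhoSD`** — (w2) EXACT Heisenberg covariance, Folland's form, over the archimedean phase-space
  map `archPhaseMap 𝕋 e′ hT (toSp (x⊗y))` in any real frame `e′` (LEAF C `ArchFollandCocycleOne.arch_covariant_rhoSD_exact`
  + `implements_adelicMpCont_proj` + `omega_archPairHom_map_tmul` with `M_f = 1`); weil-2's dictionary
  `archPhaseMap_toSp_pair` (`Weil1964/ArchDualPairThetaMajorants`) identifies that phase map in the scaled Folland frame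
  with Konno–Konno's `ι𝕎` slice by slice (to be applied in §3(b) at the CM pin).
* §3(b) (owed) (w1) strong continuity: coefficient continuity `continuous_archRepMp_apply_apply` + `continuous_cmPairSplitting`
  + the KAK upgrade of `ArchWeilContinuityKAK`.
* §3(c) (owed) (w2′) unitary lifts: Schur (`SchrodingerCovariantUniqueness`) against a unitary implementer per element,
  `|c|` a continuous character of `U(p,q) × U(r,s)` hence `1`; phase pin on the boosts by `map_slDiag_exp_eq_one`
  (tree `LinearAlgebra/Matrix/SL2DiagonalCommutator`) or at the vacuum (`JunctionHyperbolicVacuumPin`).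

Nothing here is a claim of PerL/QW8. [Folland1989, Prop. (1.43)] is the provenance of the covariance formula.
-/

set_option autoImplicit false

noncomputable section

open NumberField IsDedekindDomain
open scoped Matrix
open scoped Kronecker Classical TensorProduct
open Literature.NumberTheory.Automorphic Literature.NumberTheory.Weil1964
open Literature.RepresentationTheory.HeisenbergGroup (polar Heisenberg symplecticGroup ofSymplectic)
open Literature.NumberTheory.GelbartRogawski1991
open Literature.Analysis.SegalBargmann (rhoSD opTransport schwartzTransport toL2 LiftsTo circleSmulLIE)

namespace HodgeCM.Model.HypCensus

section Pair

variable (F E : Type) [Field F] [NumberField F] [Field E] [NumberField E] [Algebra F E]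
variable (c : E ≃ₐ[F] E) (N M : ℕ) (JV : Matrix (Fin N) (Fin N) E) (JW : Matrix (Fin M) (Fin M) E)

/-! ## §3(a) EXACT Heisenberg covariance of `archWeilRep` over the archimedean phase map (LEAF C) -/

set_option maxHeartbeats 4000000 in
/-- **(w2), Folland's form, EXACT**: in any real frame `e′` of `(F ⊗ ℝ)^n` and for any archimedean pair element `u`,
`archWeilRep u (ρ_D(p,q) Φ) = ρ_D(archPhaseMap 𝕋 e′ (toSp (archPairHom u)) (p,q)) (archWeilRep u Φ)` — exact
`rhoSD`-covariance over the archimedean phase-space map of the symplectic element (LEAF C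
`ArchFollandCocycleOne.arch_covariant_rhoSD_exact`, the cocycle being `1` on the image of `archFolland`), the
hypothesis shape `IsRhoCovariantS` / `IsPhaseCovariantSD` of the `SegalBargmann` rigidity files.  weil-2's dictionary
`archPhaseMap_toSp_pair` (`Weil1964/ArchDualPairThetaMajorants`) then identifies this phase map, in the scaled
Folland frame, with Konno–Konno's `ι𝕎` slice by slice. [Folland1989, Prop. (1.43)] -/
theorem archWeilRep_rhoSD [Algebra.IsQuadraticExtension F E] {δ : E} (hcδ : c δ = -δ) (hδ : δ ≠ 0)
    {d : F} (hd : δ * δ = algebraMap F E d) {TV : Matrix (Fin N) (Fin N) F} {TW : Matrix (Fin M) (Fin M) F}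
    (hV : TV.IsSymm) (hW : TW.IsSymm) (hVd : IsUnit TV.det) (hWd : IsUnit TW.det)
    (hJV : JV = TV.map (algebraMap F E)) (hJW : JW = TW.map (algebraMap F E))
    {n : ℕ} (e : Fin N × Fin M ≃ Fin n)
    (s : UnitaryGroup.adelicPair F E c N M JV JW →* adelicMpCont F (Fin n) (UnitaryDualPair.adelicGram F e TV TW))
    (hs : ∀ g, adelicMpCont.proj F (Fin n) (UnitaryDualPair.adelicGram F e TV TW) (s g) =
      UnitaryDualPair.toSp F E c N M e JV JW hcδ hδ hd hV hW hJV hJW g)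
    {σ : Type} [Fintype σ] (e' : (Fin n → mixedEmbedding.mixedSpace F) ≃L[ℝ] (σ → ℝ))
    (hTa : IsUnit (archMat F (Fin n) (UnitaryDualPair.adelicGram F e TV TW)))
    (u : UnitaryGroup.arch F E c N JV × UnitaryGroup.arch F E c M JW) (p q : σ → ℝ)
    (Φ : SchwartzMap (Fin n → mixedEmbedding.mixedSpace F) ℂ) :
    archWeilRep F E c N M JV JW hcδ hδ hd hV hW hVd hWd hJV hJW e s hs u (rhoSD e' p q Φ) =
      rhoSD e' (archPhaseMap (UnitaryDualPair.adelicGram F e TV TW) e' hTa (adelicMpCont.proj F (Fin n) (UnitaryDualPair.adelicGram F e TV TW) (UnitaryDualPair.pairSplitting F E c N M e JV JW s (archProdHom F E c N M JV JW u))) (p, q)).1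
        (archPhaseMap (UnitaryDualPair.adelicGram F e TV TW) e' hTa (adelicMpCont.proj F (Fin n) (UnitaryDualPair.adelicGram F e TV TW) (UnitaryDualPair.pairSplitting F E c N M e JV JW s (archProdHom F E c N M JV JW u))) (p, q)).2
        (archWeilRep F E c N M JV JW hcδ hδ hd hV hW hVd hWd hJV hJW e s hs u Φ) :=
  arch_covariant_rhoSD_exact (UnitaryDualPair.adelicGram F e TV TW) e' hTa _ _ (implements_adelicMpCont_proj (UnitaryDualPair.pairSplitting F E c N M e JV JW s (archProdHom F E c N M JV JW u)))
    (archWeilRep F E c N M JV JW hcδ hδ hd hV hW hVd hWd hJV hJW e s hs u) LinearMap.id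
    (fun Φ' f => by
      rw [LinearMap.id_apply, ← omega_pairSplitting_arch_map_tmul, adelicMpCont.omega_apply, omegaPsi_apply])
    id_indicatorSB_top_ne_zero p q Φ

/-! ## §3(c) Schur step (lift-free): covariant automorphisms over the same phase map are proportional to `archWeilRep u` -/

set_option maxHeartbeats 4000000 in
/-- **Schur, lift-free** (`SchwartzHeisenbergSchur.eq_smul_of_commute_rhoSD`): any topological automorphism `U` of
`𝓢((F ⊗ ℝ)^n)` that is exactly `rhoSD e′`-covariant over the SAME archimedean phase map as `archWeilRep u` is
proportional to it — `archWeilRep u = c • U`.  With `U` a unitary-liftable implementer (Folland's `μ₀`, theta-1's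
`hypOp`, the KK07 junction datum) this is the first step of (w2′); `|c| = 1` then comes from compactness /
the commutator lemma `map_slDiag_exp_eq_one`. [Folland1989, §4.2, the Schur remark p. 156] -/
theorem archWeilRep_eq_smul_of_covariant [Algebra.IsQuadraticExtension F E] {δ : E} (hcδ : c δ = -δ) (hδ : δ ≠ 0)
    {d : F} (hd : δ * δ = algebraMap F E d) {TV : Matrix (Fin N) (Fin N) F} {TW : Matrix (Fin M) (Fin M) F}
    (hV : TV.IsSymm) (hW : TW.IsSymm) (hVd : IsUnit TV.det) (hWd : IsUnit TW.det)
    (hJV : JV = TV.map (algebraMap F E)) (hJW : JW = TW.map (algebraMap F E))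
    {n : ℕ} (e : Fin N × Fin M ≃ Fin n)
    (s : UnitaryGroup.adelicPair F E c N M JV JW →* adelicMpCont F (Fin n) (UnitaryDualPair.adelicGram F e TV TW))
    (hs : ∀ g, adelicMpCont.proj F (Fin n) (UnitaryDualPair.adelicGram F e TV TW) (s g) =
      UnitaryDualPair.toSp F E c N M e JV JW hcδ hδ hd hV hW hJV hJW g)
    {σ : Type} [Fintype σ] (e' : (Fin n → mixedEmbedding.mixedSpace F) ≃L[ℝ] (σ → ℝ))
    (hTa : IsUnit (archMat F (Fin n) (UnitaryDualPair.adelicGram F e TV TW)))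
    (u : UnitaryGroup.arch F E c N JV × UnitaryGroup.arch F E c M JW)
    (U : SchwartzMap (Fin n → mixedEmbedding.mixedSpace F) ℂ ≃L[ℂ] SchwartzMap (Fin n → mixedEmbedding.mixedSpace F) ℂ)
    (hU : ∀ (p q : σ → ℝ) (Φ : SchwartzMap (Fin n → mixedEmbedding.mixedSpace F) ℂ),
      U (rhoSD e' p q Φ) =
        rhoSD e' (archPhaseMap (UnitaryDualPair.adelicGram F e TV TW) e' hTa (adelicMpCont.proj F (Fin n) (UnitaryDualPair.adelicGram F e TV TW) (UnitaryDualPair.pairSplitting F E c N M e JV JW s (archProdHom F E c N M JV JW u))) (p, q)).1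
          (archPhaseMap (UnitaryDualPair.adelicGram F e TV TW) e' hTa (adelicMpCont.proj F (Fin n) (UnitaryDualPair.adelicGram F e TV TW) (UnitaryDualPair.pairSplitting F E c N M e JV JW s (archProdHom F E c N M JV JW u))) (p, q)).2 (U Φ)) :
    ∃ cU : ℂ, ∀ Φ : SchwartzMap (Fin n → mixedEmbedding.mixedSpace F) ℂ,
      archWeilRep F E c N M JV JW hcδ hδ hd hV hW hVd hWd hJV hJW e s hs u Φ = cU • U Φ := by
  let A : SchwartzMap (Fin n → mixedEmbedding.mixedSpace F) ℂ →L[ℂ] SchwartzMap (Fin n → mixedEmbedding.mixedSpace F) ℂ :=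
    { toLinearMap := archWeilRep F E c N M JV JW hcδ hδ hd hV hW hVd hWd hJV hJW e s hs u
      cont := continuous_archWeilRep F E c N M JV JW hcδ hδ hd hV hW hVd hWd hJV hJW e s hs u }
  have hA : ∀ Φ, A Φ = archWeilRep F E c N M JV JW hcδ hδ hd hV hW hVd hWd hJV hJW e s hs u Φ := fun Φ => rfl
  -- `U⁻¹` is covariant the other way round
  have hUsymm : ∀ (p q : σ → ℝ) (Ψ : SchwartzMap (Fin n → mixedEmbedding.mixedSpace F) ℂ),
      U.symm (rhoSD e'
        (archPhaseMap (UnitaryDualPair.adelicGram F e TV TW) e' hTa (adelicMpCont.proj F (Fin n) (UnitaryDualPair.adelicGram F e TV TW) (UnitaryDualPair.pairSplitting F E c N M e JV JW s (archProdHom F E c N M JV JW u))) (p, q)).1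
        (archPhaseMap (UnitaryDualPair.adelicGram F e TV TW) e' hTa (adelicMpCont.proj F (Fin n) (UnitaryDualPair.adelicGram F e TV TW) (UnitaryDualPair.pairSplitting F E c N M e JV JW s (archProdHom F E c N M JV JW u))) (p, q)).2 Ψ) =
        rhoSD e' p q (U.symm Ψ) := by
    intro p q Ψ
    apply U.injective
    rw [ContinuousLinearEquiv.apply_symm_apply, hU, ContinuousLinearEquiv.apply_symm_apply]
  obtain ⟨cU, hcU⟩ := Literature.Analysis.SegalBargmann.eq_smul_of_commute_rhoSD e'
    ((U.symm : SchwartzMap (Fin n → mixedEmbedding.mixedSpace F) ℂ →L[ℂ]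
      SchwartzMap (Fin n → mixedEmbedding.mixedSpace F) ℂ).comp A) (fun p q Φ => by
      rw [ContinuousLinearMap.comp_apply, ContinuousLinearMap.comp_apply, ContinuousLinearEquiv.coe_coe, hA, hA,
        archWeilRep_rhoSD F E c N M JV JW hcδ hδ hd hV hW hVd hWd hJV hJW e s hs e' hTa u p q Φ, hUsymm])
  refine ⟨cU, fun Φ => ?_⟩
  have h := congrArg U (hcU Φ)
  rw [ContinuousLinearMap.comp_apply, ContinuousLinearEquiv.coe_coe, ContinuousLinearEquiv.apply_symm_apply, hA,
    map_smul] at h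
  exact h

/-- **(w2′) from the Schur step**: if `archWeilRep u = c • U` with `‖c‖ = 1` and the transported `U` lifts to a unitary `V` of
`L²(ℝ^σ)`, then the transported `archWeilRep u` lifts to the unitary `V` followed by the unimodular scaling `c`
(`circleSmulLIE`) — the clause `IsArchWeilDatum.exists_lift` for this element. -/
theorem liftsTo_opTransport_archWeilRep [Algebra.IsQuadraticExtension F E] {δ : E} (hcδ : c δ = -δ) (hδ : δ ≠ 0)
    {d : F} (hd : δ * δ = algebraMap F E d) {TV : Matrix (Fin N) (Fin N) F} {TW : Matrix (Fin M) (Fin M) F}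
    (hV : TV.IsSymm) (hW : TW.IsSymm) (hVd : IsUnit TV.det) (hWd : IsUnit TW.det)
    (hJV : JV = TV.map (algebraMap F E)) (hJW : JW = TW.map (algebraMap F E))
    {n : ℕ} (e : Fin N × Fin M ≃ Fin n)
    (s : UnitaryGroup.adelicPair F E c N M JV JW →* adelicMpCont F (Fin n) (UnitaryDualPair.adelicGram F e TV TW))
    (hs : ∀ g, adelicMpCont.proj F (Fin n) (UnitaryDualPair.adelicGram F e TV TW) (s g) =
      UnitaryDualPair.toSp F E c N M e JV JW hcδ hδ hd hV hW hJV hJW g)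
    {σ : Type} [Fintype σ] [DecidableEq σ] (e' : (Fin n → mixedEmbedding.mixedSpace F) ≃L[ℝ] (σ → ℝ))
    (u : UnitaryGroup.arch F E c N JV × UnitaryGroup.arch F E c M JW)
    (U : SchwartzMap (Fin n → mixedEmbedding.mixedSpace F) ℂ ≃L[ℂ] SchwartzMap (Fin n → mixedEmbedding.mixedSpace F) ℂ)
    (cU : ℂ) (hcU : ∀ Φ, archWeilRep F E c N M JV JW hcδ hδ hd hV hW hVd hWd hJV hJW e s hs u Φ = cU • U Φ)
    (hc1 : ‖cU‖ = 1)
    (V : MeasureTheory.Lp ℂ 2 (MeasureTheory.volume : MeasureTheory.Measure (σ → ℝ)) ≃ₗᵢ[ℂ]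
      MeasureTheory.Lp ℂ 2 (MeasureTheory.volume : MeasureTheory.Measure (σ → ℝ)))
    (hUV : LiftsTo (opTransport e'
        ((U : SchwartzMap (Fin n → mixedEmbedding.mixedSpace F) ℂ →L[ℂ] SchwartzMap (Fin n → mixedEmbedding.mixedSpace F) ℂ) :
          SchwartzMap (Fin n → mixedEmbedding.mixedSpace F) ℂ →ₗ[ℂ] SchwartzMap (Fin n → mixedEmbedding.mixedSpace F) ℂ))
      (V.toContinuousLinearEquiv : _ →L[ℂ] _)) :
    LiftsTo (opTransport e' (archWeilRep F E c N M JV JW hcδ hδ hd hV hW hVd hWd hJV hJW e s hs u))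
      ((V.trans (circleSmulLIE _ (⟨cU, mem_sphere_zero_iff_norm.2 hc1⟩ : Circle))).toContinuousLinearEquiv : _ →L[ℂ] _) := by
  intro f
  have h1 : opTransport e' (archWeilRep F E c N M JV JW hcδ hδ hd hV hW hVd hWd hJV hJW e s hs u) f =
      cU • opTransport e' ((U : SchwartzMap (Fin n → mixedEmbedding.mixedSpace F) ℂ →L[ℂ]
        SchwartzMap (Fin n → mixedEmbedding.mixedSpace F) ℂ) :
          SchwartzMap (Fin n → mixedEmbedding.mixedSpace F) ℂ →ₗ[ℂ] SchwartzMap (Fin n → mixedEmbedding.mixedSpace F) ℂ) f := by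
    rw [Literature.Analysis.SegalBargmann.opTransport_apply, Literature.Analysis.SegalBargmann.opTransport_apply, hcU, map_smul]
    rfl
  rw [h1, map_smul, hUV f]
  rfl

end Pair

end HodgeCM.Model.HypCensus

end
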